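import Summits.QuantumFields.BalabanUV.T4Continuum.Support.NE7HintOfCubeChartGeneric
import Summits.QuantumFields.BalabanUV.T4Continuum.Support.NE7ClassCurrentBoundGeneric
import Summits.QuantumFields.BalabanUV.T4Continuum.Support.NE7CubeChartOfLandauELGeneric
import HarnessLib

/-!
# NE7HintOfLandauELChartGeneric — PORT MAP P2, FILE 3: (8)∃ FROM ANY LOCAL GAUGE WITH THE LATTICE LANDAU CONDITION AND THE SUP LETTER, FOR EVERY UNITARY GAUGE GROUP `U(n)` AND
# EVERY BLOCK SIZE `L ≥ 2` ON T⁴ — `NE7HintOfLandauELChartSU2DecSlice.hint_of_landauELChart_SU2` (F306, `card n = 2`, `L = 2`) RE-ISSUED GENERICALLY over P2.2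
# `hint_of_cubeChart_generic`, P2.3a `exists_classCurrentConst_generic` (class current of tangent-critical configurations, regime from the class package + one more radius shrink
# `ε ≤ 1∕(2·thetaLoc 4 L + 1)`) and P2.3b `cubeChart_of_landauEL_generic` (letter width `L′ = 10L + 2ℓ + 12`)

Cell `pub-balaban`, rung (B)+1 sub-cell t4, lineage `b2b-balaban-t4-ne7-p1`, generation 109 (CRUX PROVER NE7 #1 = OWNER of BINDER row NE7).  Memo
`t4/b2b-balaban-t4-ne7-p1-g109/ROAD-G109.md` §3 (PORT MAP item P2.3).  NON-VERBATIM POINTS: cover factor `4ℓ + 20L + 24`; sup-cube radius `(nbRad 4 L + 2ℓ + 12)·L^{k+1} + 2`; the chart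
polynomial `A′ = 62A + K(2C + 48) + 34KA` with `K = (10L + 12)²` (record: `K = 1024`); `r ≤ ε∕L² ≤ ε∕4`.
WHAT ([folklore]; 0 def, 0 sorry).  **`hint_of_landauELChart_generic`**: F306 TOKEN FOR TOKEN under the recipe: for every `L ≥ 2`, `A ≥ 0`, `p`: `∃ C_E > 0, ∃ ℓ ≥ 1, ∃ ε₀ > 0, ∀ 0 < ε ≤ ε₀,
∃ β₀ > 0, ∀ 0 < β ≤ β₀, ∀ N ≥ 1, ∀ αh νh κh c₀`: the strict line (with `C_E`), `c₀ ≤ A(ℓ+1)^p`, (LSUP-EL) on the `(4ℓ+20L+24)`-fold cover and `hdecomp` over `𝒯_E` ⟹ `∃ δ_V > 0`, over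
the small data every level has a constrained minimiser over `sfClass 4 L N ε` with `SmallField U a`, `0 ≤ a < ε∕(L^k)²`.
HONEST FRAMING (page 1): composition of landed kernel theorems; constants existential; nothing of Bałaban's asserted; (LSUP-EL), `hdecomp`, the strict line REMAIN HYPOTHESES (generic
discharge = PORT MAP P2.4–P2.6); NE7 NOT proved; spine 0∕9; finite T⁴ rung (B)+1 — NOT infinite volume, NOT mass gap, NOT BetaPertH, NOT Clay (continuum YM on T⁴ ⇐ BetaPertH ∧ nine
spine estimates).
-/

set_option autoImplicit false

open scoped BigOperators Matrix Matrix.Norms.L2Operator Topology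
open NormedSpace Finset Set Filter

namespace Summit.QuantumFields.BalabanUV.T4Continuum.NE7HintOfLandauELChartGeneric

open Literature.MathematicalPhysics.QuantumFieldTheory.Balaban1983to89
open B7Prop1Explicit B7Prop2Explicit MatrixLog UnitaryModel
open B4TorusKernel.MultiPeriod (torusSupNorm)
open B8Ineq132 (covDiv)
open T4AveragingDeficitWall (Ad IsUnitaryCfg IsSkewDir SmallField vary curl curlSq dirSq dirL1)
open T4AveragingDeficitWallBoundary (IsPeriodicCfg periodBox)
open AveragingDeficitPeriodicCounting (IsPeriodicDir)
open AveragingDeficitMultiLevelPrep (LevelSmall tower TangentIter)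
open BlockAverageVaryHolo (nbRad)
open MinimalActionLevels (perWin)
open MinimalActionSandwich (IsMinimiser admissible)
open MinimalActionRate (sfClass)
open NE3HessForm (dAction)
open NE3QbarIterCovLiftPrep (cruxC)
open NE3RightInverseSolveLetters (thetaLoc cruxC_le_thetaLoc cruxC_nonneg)
open NE3EnergyShapes (IsUnitarySite)
open BlockAveragePushDirSplit (flat)
open NE3EnergyWeightedShapes (energyNormW)
open NE7MeanZeroGaugeSliceW (energyBlockLandauW)
open NE7HintOfCubeChartGeneric (hint_of_cubeChart_generic)
open NE7ClassCurrentBoundGeneric (exists_classCurrentConst_generic)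
open NE7CubeChartOfLandauELGeneric (cubeChart_of_landauEL_generic)
open NE7EnergyClassPoincareGeneric (classPackage)
open Literature.NumberTheory.Sieve.SquarefreeSums (exp_sub_one_le_two_mul)

noncomputable section

variable {n : Type*} [Fintype n] [DecidableEq n]

set_option maxHeartbeats 1600000 in
/-- **P2.3 — F306 GENERIC: (8)∃ FROM ANY LOCAL GAUGE WITH THE LATTICE LANDAU CONDITION AND THE SUP LETTER, every `U(n)`, every `L ≥ 2`, on T⁴** (statement in the file header).
[folklore] -/
theorem hint_of_landauELChart_generic [Nonempty n] {L : ℕ} (hL : 2 ≤ L) {A : ℝ} (hA : 0 ≤ A) (p : ℕ) :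
    ∃ CE : ℝ, 0 < CE ∧ ∃ ℓ : ℕ, 1 ≤ ℓ ∧ ∃ ε₀ : ℝ, 0 < ε₀ ∧ ∀ ε : ℝ, 0 < ε → ε ≤ ε₀ → ∃ β₀ : ℝ, 0 < β₀ ∧ ∀ β : ℝ, 0 < β → β ≤ β₀ →
    ∀ (N : ℕ) [NeZero N] (αh νh κh c₀ : ℝ), 1 ≤ N →
    -- the k-free ceilings `(α̂, ν̂, κ̂)` of the honest per-pair binder and ONE k-free strict line (F327)
    2 * κh < ((((1 / 2 - νh ^ 2) / (2 * (1 + CE)) - νh ^ 2) / 2 - 576 * ((4 : ℕ) : ℝ) * (αh ^ 2 * Real.exp (2 * αh))) / (Fintype.card n : ℝ) - 28 * ((4 : ℕ) : ℝ) * (ε + 7 * αh ^ 2)) →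
    0 ≤ c₀ → c₀ ≤ A * ((ℓ : ℝ) + 1) ^ p →
    -- (LSUP-EL): a local gauge with the Landau condition (EL form) and the sup letter, on the `(4ℓ+64)`-fold cover
    (∀ D : Site 4 → Fin 4 → (Matrix n n ℂ)ˣ, IsUnitaryCfg D → IsPeriodicCfg D ((N * (4 * ℓ + 20 * L + 24)) : ℤ) → SmallField D (4 * (Real.exp β - 1)) →
      ∀ (k : ℕ), ∀ U ∈ admissible (sfClass 4 L (N * (4 * ℓ + 20 * L + 24)) ε) L (k + 1) D,
      (∀ φ : Site 4 → Fin 4 → Matrix n n ℂ, IsSkewDir φ → IsPeriodicDir φ (((N * (4 * ℓ + 20 * L + 24)) * L ^ (k + 1) : ℕ) : ℤ) → TangentIter L k U φ →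
        dAction U φ (perWin 4 ((N * (4 * ℓ + 20 * L + 24)) * L ^ (k + 1))) = 0) →
      ∀ r : ℝ, 0 ≤ r → r ≤ (1 / (L : ℝ) ^ 2 * ε) → SmallField U (r / ((L : ℝ) ^ (k + 1)) ^ 2) →
      ∀ z : Site 4, ∃ (u : Site 4 → (Matrix n n ℂ)ˣ) (A : Site 4 → Fin 4 → Matrix n n ℂ), (∀ x, u x ∈ unitaryUnits (Matrix n n ℂ)) ∧
        (∀ (p : Site 4) (μ : Fin 4), (∀ i, |p i - z i| ≤ (((nbRad 4 L + 2 * ℓ + 12) * L ^ (k + 1) + 2 : ℕ) : ℤ)) → gaugeAct u U p μ = expUnit (A p μ)) ∧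
        (∀ (p : Site 4) (μ : Fin 4), (∀ i, |p i - z i| ≤ (((nbRad 4 L + 2 * ℓ + 12) * L ^ (k + 1) + 2 : ℕ) : ℤ)) → A p μ ∈ skewAdjoint (Matrix n n ℂ)) ∧
        (∀ (p : Site 4) (μ : Fin 4), (∀ i, |p i - z i| ≤ (((nbRad 4 L + 2 * ℓ + 12) * L ^ (k + 1) + 2 : ℕ) : ℤ)) → ‖A p μ‖ ≤ c₀ * (r + 4 * (Real.exp β - 1) + ε) / (L : ℝ) ^ (k + 1)) ∧
        (∀ (y : Site 4), (∀ i, |y i - z i| ≤ (((nbRad 4 L + 2 * ℓ + 12) * L ^ (k + 1) + 2 : ℕ) : ℤ)) →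
          ∑ κ : Fin 4, ((((gaugeAct u U y κ : (Matrix n n ℂ)ˣ) : Matrix n n ℂ) - ((gaugeAct u U y κ : (Matrix n n ℂ)ˣ) : Matrix n n ℂ)ᴴ)
            - (((gaugeAct u U (y - e κ) κ : (Matrix n n ℂ)ˣ) : Matrix n n ℂ) - ((gaugeAct u U (y - e κ) κ : (Matrix n n ℂ)ˣ) : Matrix n n ℂ)ᴴ)) = 0)) →
    -- THE HONEST PER-PAIR BINDER `hdecomp` on the data class (F327's)
    (∀ D : Site 4 → Fin 4 → (Matrix n n ℂ)ˣ, IsUnitaryCfg D → IsPeriodicCfg D (N : ℤ) → SmallField D (4 * (Real.exp β - 1)) → ∀ (k : ℕ), ∀ Us ∈ admissible (sfClass 4 L N ε) L (k + 1) D, SmallField Us ((1 / (L : ℝ) ^ 2 * ε / 2) / ((L : ℝ) ^ (k + 1)) ^ 2) → (∀ φ : Site 4 → Fin 4 → Matrix n n ℂ, IsSkewDir φ → IsPeriodicDir φ ((N * L ^ (k + 1) : ℕ) : ℤ) → TangentIter L k Us φ → dAction Us φ (perWin 4 (N * L ^ (k + 1))) = 0) → ∀ U' ∈ admissible (sfClass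 4 L N ε) L (k + 1) D,
      ∃ (u : Site 4 → (Matrix n n ℂ)ˣ) (X XT XN : Site 4 → Fin 4 → Matrix n n ℂ) (α ν κ : ℝ),
        IsUnitarySite u ∧ IsSkewDir X ∧ IsPeriodicDir X ((N * L ^ (k + 1) : ℕ) : ℤ) ∧ 0 ≤ α ∧ (∀ x μ, ‖X x μ‖ ≤ α) ∧
        gaugeAct u U' = vary Us X 1 ∧
        X = XT + XN ∧ XT ∈ energyBlockLandauW (d := 4) (n := n) L N (k + 1) Us ∧ IsSkewDir XN ∧ 0 ≤ ν ∧
        energyNormW L (k + 1) Us XN (periodBox (d := 4) (N * L ^ (k + 1)))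
          ≤ ν * energyNormW L (k + 1) Us X (periodBox (d := 4) (N * L ^ (k + 1))) ∧
        ε / ((L : ℝ) ^ (k + 1)) ^ 2 * (∑ p ∈ perWin 4 (N * L ^ (k + 1)), ‖curl Us XN p‖)
          ≤ κ * energyNormW L (k + 1) Us X (periodBox (d := 4) (N * L ^ (k + 1))) ^ 2 ∧
        α * (L : ℝ) ^ (k + 1) ≤ αh ∧ ν ≤ νh ∧ κ ≤ κh) →
    ∃ δV : ℝ, 0 < δV ∧
      ∀ V ∈ {V : Site 4 → Fin 4 → (Matrix n n ℂ)ˣ | IsUnitaryCfg V ∧ IsPeriodicCfg V (N : ℤ) ∧ SmallField V δV},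
      ∀ k : ℕ, ∃ U : Site 4 → Fin 4 → (Matrix n n ℂ)ˣ, IsMinimiser 4 (sfClass 4 L N ε) L N k V U ∧
        ∃ a : ℝ, 0 ≤ a ∧ a < ε / ((L : ℝ) ^ k) ^ 2 ∧ SmallField U a
    := by
  haveI : NeZero L := ⟨by omega⟩
  have hL1 : 1 ≤ L := by omega
  have hL0 : (0 : ℝ) < L := by exact_mod_cast (show 0 < L by omega)
  have hL2r : (2 : ℝ) ≤ (L : ℝ) := by exact_mod_cast hL
  obtain ⟨C, hC0, hC⟩ := exists_classCurrentConst_generic (n := n) hL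
  obtain ⟨θ₀, CF, CE', hθ₀, -, -, -, -, -, hls, -, -⟩ := classPackage (n := n) (d := 4) (by norm_num) hL
  -- the width `L′ = 10L + 2ℓ + 12 ≤ (10L + 12)(ℓ + 1)` and the polynomial chart constant
  set K : ℝ := (10 * (L : ℝ) + 12) ^ 2 with hK
  have hK0 : 0 < K := by positivity
  set A' : ℝ := 62 * A + K * (2 * C + 48) + 34 * K * A with hA'
  have hA'0 : 0 ≤ A' := by positivity
  obtain ⟨CE, hCE, ℓ, hℓ1, ε₀, hε₀, H⟩ := hint_of_cubeChart_generic (n := n) hL (A := A') hA'0 (p + 2)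
  have hℓ0 : (0 : ℝ) ≤ (ℓ : ℝ) := Nat.cast_nonneg ℓ
  set Lp : ℝ := 10 * (L : ℝ) + 2 * (ℓ : ℝ) + 12 with hLp
  have hLp0 : 0 < Lp := by positivity
  set T : ℝ := 1 / (1152 * Lp * (A * ((ℓ : ℝ) + 1) ^ p + 1)) with hT
  have hT0 : 0 < T := by positivity
  -- the regime of the class current bound: `ε ≤ 1`, `2·thetaLoc·ε ≤ 1`, the level family
  have hth0 : 0 ≤ thetaLoc 4 L := (cruxC_nonneg 4 L).trans (cruxC_le_thetaLoc 4 L)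
  set θ₁ : ℝ := min θ₀ (1 / (2 * thetaLoc 4 L + 1)) with hθ₁
  have hθ₁0 : 0 < θ₁ := lt_min hθ₀ (by positivity)
  refine ⟨CE, hCE, ℓ, hℓ1, min ε₀ (min θ₁ (T / 3)), lt_min hε₀ (lt_min hθ₁0 (by positivity)), fun ε hε hεle => ?_⟩
  obtain ⟨β₀, hβ₀, H2⟩ := H ε hε (hεle.trans (min_le_left _ _))
  refine ⟨min β₀ (min 1 (T / 24)), lt_min hβ₀ (lt_min one_pos (by positivity)), ?_⟩
  intro β hβ hβle N _ αh νh κh c₀ hN hline hc₀ hc₀b hLSUP hdecomp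
  have hεθ₁ : ε ≤ θ₁ := hεle.trans ((min_le_right _ _).trans (min_le_left _ _))
  have hεθ₀ : ε ≤ θ₀ := hεθ₁.trans (min_le_left _ _)
  have hε1 : ε ≤ 1 := by
    have h : θ₁ ≤ 1 / (2 * thetaLoc 4 L + 1) := min_le_right _ _
    have h' : 1 / (2 * thetaLoc 4 L + 1) ≤ 1 := by rw [div_le_one (by positivity)]; linarith
    linarith
  have hθε : 2 * thetaLoc 4 L * ε ≤ 1 := by
    have h : ε ≤ 1 / (2 * thetaLoc 4 L + 1) := hεθ₁.trans (min_le_right _ _)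
    have h2 : 2 * thetaLoc 4 L * ε ≤ 2 * thetaLoc 4 L * (1 / (2 * thetaLoc 4 L + 1)) := mul_le_mul_of_nonneg_left h (by positivity)
    have h3 : 2 * thetaLoc 4 L * (1 / (2 * thetaLoc 4 L + 1)) ≤ 1 := by
      rw [← mul_div_assoc, mul_one, div_le_one (by positivity)]; linarith
    linarith
  have hlsε : ∀ k : ℕ, LevelSmall 4 L k (ε / ((L : ℝ) ^ (k + 1)) ^ 2) := hls hε.le hεθ₀
  have hεT : ε ≤ T / 3 := hεle.trans ((min_le_right _ _).trans (min_le_right _ _))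
  have hβ1 : β ≤ 1 := hβle.trans ((min_le_right _ _).trans (min_le_left _ _))
  have hβT : β ≤ T / 24 := hβle.trans ((min_le_right _ _).trans (min_le_right _ _))
  have hexpβ : 4 * (Real.exp β - 1) ≤ T / 3 := by
    have h := exp_sub_one_le_two_mul hβ.le hβ1; linarith
  set c₁ : ℝ := 62 * c₀ + Lp ^ 2 * (2 * C + 32 * c₀ + 48 + 2 * 0) with hc₁
  have hc₁0 : 0 ≤ c₁ := by positivity
  have hpow2 : ((ℓ : ℝ) + 1) ^ p ≤ ((ℓ : ℝ) + 1) ^ (p + 2) := pow_le_pow_right₀ (by linarith) (by omega)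
  have hsq : Lp ^ 2 ≤ K * ((ℓ : ℝ) + 1) ^ 2 := by
    rw [hLp, hK, ← mul_pow]
    apply pow_le_pow_left₀ (by positivity)
    nlinarith
  have hpow_eq : ((ℓ : ℝ) + 1) ^ (p + 2) = ((ℓ : ℝ) + 1) ^ 2 * ((ℓ : ℝ) + 1) ^ p := by ring
  have hQ : 0 ≤ A * ((ℓ : ℝ) + 1) ^ p := by positivity
  have hc₁b : c₁ ≤ A' * ((ℓ : ℝ) + 1) ^ (p + 2) := by
    have h1 : 2 * C + 32 * c₀ + 48 + 2 * 0 ≤ 2 * C + 48 + 34 * (A * ((ℓ : ℝ) + 1) ^ p) := by linarith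
    have h2 : Lp ^ 2 * (2 * C + 32 * c₀ + 48 + 2 * 0) ≤ (K * ((ℓ : ℝ) + 1) ^ 2) * (2 * C + 48 + 34 * (A * ((ℓ : ℝ) + 1) ^ p)) :=
      mul_le_mul hsq h1 (by positivity) (by positivity)
    have h3 : 62 * c₀ ≤ 62 * A * ((ℓ : ℝ) + 1) ^ (p + 2) := by nlinarith
    have h4 : (K * ((ℓ : ℝ) + 1) ^ 2) * (2 * C + 48 + 34 * (A * ((ℓ : ℝ) + 1) ^ p))
        = K * (2 * C + 48) * ((ℓ : ℝ) + 1) ^ 2 + 34 * K * A * ((ℓ : ℝ) + 1) ^ (p + 2) := by rw [hpow_eq]; ring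
    have h5 : K * (2 * C + 48) * ((ℓ : ℝ) + 1) ^ 2 ≤ K * (2 * C + 48) * ((ℓ : ℝ) + 1) ^ (p + 2) := by
      have : ((ℓ : ℝ) + 1) ^ 2 ≤ ((ℓ : ℝ) + 1) ^ (p + 2) := pow_le_pow_right₀ (by linarith) (by omega)
      exact mul_le_mul_of_nonneg_left this (by positivity)
    have e6 : A' * ((ℓ : ℝ) + 1) ^ (p + 2) = 62 * A * ((ℓ : ℝ) + 1) ^ (p + 2) + K * (2 * C + 48) * ((ℓ : ℝ) + 1) ^ (p + 2)
        + 34 * K * A * ((ℓ : ℝ) + 1) ^ (p + 2) := by rw [hA']; ring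
    rw [hc₁, e6]; linarith
  have hc₀b' : c₀ ≤ A' * ((ℓ : ℝ) + 1) ^ (p + 2) := by
    have h1 : A * ((ℓ : ℝ) + 1) ^ p ≤ A * ((ℓ : ℝ) + 1) ^ (p + 2) := mul_le_mul_of_nonneg_left hpow2 hA
    have h2 : A * ((ℓ : ℝ) + 1) ^ (p + 2) ≤ A' * ((ℓ : ℝ) + 1) ^ (p + 2) := by
      apply mul_le_mul_of_nonneg_right _ (by positivity); rw [hA']; nlinarith
    linarith
  refine H2 β hβ (hβle.trans (min_le_left _ _)) N αh νh κh c₀ c₁ hN hline hc₀ hc₀b' hc₁0 hc₁b ?_ hdecomp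
  intro D hDu hDP hDs k U hU hcrit r hr0 hr hUr z
  haveI : NeZero (N * (4 * ℓ + 20 * L + 24)) := ⟨mul_ne_zero (NeZero.ne N) (by omega)⟩
  have hL2sq : (4 : ℝ) ≤ (L : ℝ) ^ 2 := by nlinarith
  have hr4 : r ≤ ε / 4 := by
    have e := hr
    have h1 : 1 / (L : ℝ) ^ 2 * ε ≤ 1 / 4 * ε := by
      apply mul_le_mul_of_nonneg_right _ hε.le
      exact div_le_div_of_nonneg_left (by norm_num) (by norm_num) hL2sq
    linarith
  have hr14 : r ≤ 1 / 4 := by linarith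
  have hcur := hC (N * (4 * ℓ + 20 * L + 24)) ε hε hε1 hθε hlsε D k U hU hcrit r hr0 hr14 hUr
  obtain ⟨u, A₀, hu, hUA, hskew, hA0, hEL⟩ := hLSUP D hDu hDP hDs k U hU hcrit r hr0 hr hUr z
  have ht : r + 4 * (Real.exp β - 1) + ε ≤ 1 / (1152 * (10 * (L : ℝ) + 2 * (ℓ : ℝ) + 12) * (c₀ + 1)) := by
    rw [← hLp]
    have h1 : r + 4 * (Real.exp β - 1) + ε ≤ T := by linarith
    have h2 : T ≤ 1 / (1152 * Lp * (c₀ + 1)) := by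
      rw [hT]; apply div_le_div_of_nonneg_left (by norm_num) (by positivity)
      exact mul_le_mul_of_nonneg_left (by linarith) (by positivity)
    linarith
  have hM1 : (1 : ℤ) ≤ ((L ^ (k + 1) : ℕ) : ℤ) := by exact_mod_cast Nat.one_le_pow _ _ (by omega)
  have hsub : ∀ (q : Site 4), (∀ i, |q i - z i| ≤ (((nbRad 4 L + 2 * ℓ + 11) * L ^ (k + 1) : ℕ) : ℤ)) →
      ∀ i, |q i - z i| ≤ (((nbRad 4 L + 2 * ℓ + 12) * L ^ (k + 1) + 2 : ℕ) : ℤ) := fun q hq i =>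
    (hq i).trans (by push_cast at hM1 ⊢; nlinarith [hM1])
  refine ⟨u, A₀, hu, fun q μ hq => hUA q μ (hsub q hq), fun q μ hq => hskew q μ (hsub q hq), fun q μ hq => hA0 q μ (hsub q hq), fun q μ τ hq _ => ?_⟩
  exact cubeChart_of_landauEL_generic (n := n) hL ℓ k hr0 hε.le hβ.le hc₀ hC0 ht hUr hcur hu z hUA hskew hA0 hEL q μ τ hq

end

end Summit.QuantumFields.BalabanUV.T4Continuum.NE7HintOfLandauELChartGeneric
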